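import Mathlib
import Summits.MatrixMultiplication.MatrixMultiplication.Theses.FourierTwoFamiliesModP

/-!
# Line `pair-shadow-identity` for crux `PrimeDensityDecay` (stmt-MatrixMultiplication-14311)

Skeleton (crux-plan, planner, 2026-08-16).  Route decl:
`Summit.MatrixMultiplication.MatrixMultiplication.Theses.FourierTwoFamiliesModP.PrimeDensityDecay`
(`∀ ε > 0 ∃ s₀, ∀ p prime, ∀ balanced SDPP (A i, B i)_{i<n} in ZMod p with |A i| = |B i| = s ≥ s₀,
n·s ≤ ε·p`).

## The lever, as cut here

Notation: `X = ⊔ A i`, `Y = ⊔ B j`.  For a CROSS PAIR `(a, a') ∈ A i × A j` (`i ≠ j`) put `d = a − a'`.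
Clause (X) says literally that the translate `B j + d` meets `Y` only inside `B i`; so every cross
pair is exactly one of
* an ESCAPE: `B j + d` misses `Y` entirely, or
* a CONTACT: `B j + d` meets `Y` (inside `B i`), hence `d ∈ Z_{ij} := (A i − A j) ∩ (B i − B j)`.
The pair-shadow identity (♣) `(X − A j) ∩ (Y − B j) = {0} ⊔ ⨆_{i≠j} Z_{ij}` (idea card; proved as
`pairShadowIdentity'_holds` / `pairShadowDisjoint_holds` in TRIAGE-r1-3-W1.lean) is the statement that
the contact shifts of column `j` lie in PAIRWISE DISJOINT sets `Z_{ij}`: a contact shift `d` of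
column `j` determines its row `i`, and carries exactly `|A i ∩ (A j + d)|` cross pairs.  Hence
(stub 1, provable now) contacts through shifts of overlap `≤ U` ("thin") number at most
`U · n · (2N − 1)`; in a DENSE configuration (`n s > ε N`) with `U = ⌊ε s / 8⌋` they are negligible,
so a dense configuration that is not POROUS (fewer than `n² s²/8` escapes) has at least `n² s²/8`
FAT CONTACTS (`|A i ∩ (A j + d)| > U`).  A fat overlap `F = A i ∩ (A j + d)` gives
`F − F ⊆ (A i − A i) ∩ (A j − A j)`; stub 3 (an inverse theorem of Balog–Szemerédi–Gowers / Freiman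
type in the dense regime, OPEN, size L) globalises this to a subfamily `S` and a set `E` with
`E − E ⊆ A i − A i` for all `i ∈ S` and `|S|·|E| ≫ n`; stub 2 (provable now: the exclusion zone
of (W)+(X) makes the translates `Y_S + e`, `e ∈ E`, pairwise disjoint — the generalisation of the
disprover's `common_pattern_bound`) gives `|E|·|S|·s ≤ 2N`, contradicting density.  So a dense
configuration with `s` large is porous (for an average class `j`, at least `|Y|/8` translates
`B j + d`, `d ∈ (−N, N)`, lie in the complement of `Y`).  Stub 4 (the HARDEST, XL, open: the
density increment that the card's popularity branch (P) feeds) says a porous dense configuration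
has a strictly denser configuration of the same class size at a strictly smaller integer scale.
The composition `PrimeDensityDecay_of` reads a `ZMod p` configuration in `[0, p) ⊂ ℤ` (casting can
only delete solutions of the 4-term relation, so (W),(X) persist) and runs the minimal-bad-scale
induction.

All statements are at INTEGER SCALE `N` (host `[0, N) ⊂ ℤ`, density `n s / N`), where long
sub-progressions re-coordinatise without loss; (W),(X) are the route's clauses verbatim, read in `ℤ`.
Disproof.lean obstructions honoured: `_false_without_X` (stubs 1, 2 use (X) — column disjointness,
translate disjointness), `_false_without_W` / `_W'` (stub 2 uses directness at the last step; stub 1's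
`n = 1` case uses `|A + B| = s²`), `translate_bound_tight` (the translate family is porous with escape
fraction `1 − 1/s` and satisfies stubs 2–3 with `E = [0, s)`, `S = univ`, reproducing `n s² ≤ 2N`).
-/

namespace Summit.MatrixMultiplication.MatrixMultiplication.Cruxes.PrimeDensityDecay.PairShadowIdentity

open scoped BigOperators
open Classical
open Summit.MatrixMultiplication.MatrixMultiplication.Theses.FourierTwoFamiliesModP

/-! ## Objects -/

/-- Integer-scale balanced SDPP configuration: `n` pairs of `s`-subsets of `[0, N) ⊂ ℤ` with
(W) (each `A i ⊕ B i` direct) and (X) (the route's 4-variable clause), verbatim in `ℤ`. -/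
def IsIntConfig (N n s : ℕ) (A B : Fin n → Finset ℤ) : Prop :=
  (∀ i : Fin n, A i ⊆ Finset.Ico (0 : ℤ) N) ∧ (∀ i : Fin n, B i ⊆ Finset.Ico (0 : ℤ) N) ∧
  (∀ i : Fin n, (A i).card = s ∧ (B i).card = s) ∧
  (∀ i : Fin n, ∀ a ∈ A i, ∀ a' ∈ A i, ∀ b ∈ B i, ∀ b' ∈ B i,
      (a - a') + (b - b') = 0 → a = a' ∧ b = b') ∧
  (∀ i j k : Fin n, ∀ a ∈ A i, ∀ a' ∈ A j, ∀ b ∈ B j, ∀ b' ∈ B k,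
      (a - a') + (b - b') = 0 → i = k)

/-- ESCAPES: cross pairs `(a, a') ∈ A i × A j`, `i ≠ j`, whose translate `B j + (a − a')` misses
`Y = ⋃ B k` entirely. -/
noncomputable def escapes {n : ℕ} (A B : Fin n → Finset ℤ) : ℕ :=
  ∑ i : Fin n, ∑ j : Fin n, if i = j then 0 else
    ((A i ×ˢ A j).filter (fun q : ℤ × ℤ => ∀ b ∈ B j, ∀ k : Fin n, q.1 - q.2 + b ∉ B k)).card

/-- FAT CONTACTS at overlap level `U`: cross pairs `(a, a') ∈ A i × A j`, `i ≠ j`, whose translate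
`B j + (a − a')` meets `Y` (by (X) it then meets `Y` inside `B i` only) and with
`|A i ∩ (A j + (a − a'))| > U`. -/
noncomputable def fatContacts {n : ℕ} (U : ℕ) (A B : Fin n → Finset ℤ) : ℕ :=
  ∑ i : Fin n, ∑ j : Fin n, if i = j then 0 else
    ((A i ×ˢ A j).filter (fun q : ℤ × ℤ =>
      (∃ b ∈ B j, ∃ k : Fin n, q.1 - q.2 + b ∈ B k) ∧
      U < ((A i).filter (fun x : ℤ => x - (q.1 - q.2) ∈ A j)).card)).card

/-! ## Stub statements (namespace `Spec`: the Props, named like the registered stubs so that the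
hypotheses of `PrimeDensityDecay_of` are admissible BY NAME for the skeleton audit) -/

namespace Spec

/-- STUB 1 (thin-contact wall: dense and not porous ⇒ fat-contact-dominated; PROVABLE NOW, size M).
For a dense integer configuration (`ε N < n s`, `s ≥ s₀(ε)`), any overlap level `U ≤ ε s / 8`, and
fewer than `n² s²/8` escapes, at least `n² s²/8` cross pairs are fat contacts.
Proof sketch: cross pairs (`n(n−1)s²` of them) = escapes ⊔ contacts; a contact `(a,a') ∈ A i × A j`
has `d = a − a' ∈ Z_{ij} = (A i − A j) ∩ (B i − B j)` by (X); for fixed `j`, (X) again shows that a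
shift `d ∈ (A i' − A j) ∩ (B i − B j)` forces `i' = i`, so `(j, d)` determines the row `i` of every
contact over it and the fibre has exactly `|A i ∩ (A j + d)|` pairs; thin contacts (`≤ U`) therefore
number `≤ U · n · #{d ∈ (−N, N)} = U n (2N − 1) < n² s²/4` by density; hence
`fat ≥ n(n−1)s² − n²s²/4 − n²s²/8 ≥ n²s²/8` for `n ≥ 2`; for `n = 1` density is impossible once
`s ≥ 2/ε` ((W): `|A 0 + B 0| = s² ≤ 2N − 1 < 2s/ε`), and `n = 0` is trivial. -/
def stub_thinContactWall : Prop :=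
  ∀ ε : ℝ, 0 < ε → ∃ s₀ : ℕ, ∀ (N n s U : ℕ) (A B : Fin n → Finset ℤ),
    IsIntConfig N n s A B → s₀ ≤ s → ε * (N : ℝ) < (n : ℝ) * (s : ℝ) → (U : ℝ) ≤ ε * s / 8 →
    8 * escapes A B < n ^ 2 * s ^ 2 →
    n ^ 2 * s ^ 2 ≤ 8 * fatContacts U A B

/-- STUB 2 (common-difference packing; PROVABLE NOW, size M).
If `E − E` consists of within-class `A`-differences of every class in `S`, then the translates
`(⊔_{i∈S} B i) + e`, `e ∈ E`, are pairwise disjoint `s|S|`-subsets of `[0, 2N − 1)`: a coincidence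
`b + e = b' + e'` (`b ∈ B i`, `b' ∈ B k`, `e ≠ e'`, `e − e' = a − a'` with `a, a' ∈ A k`) is the
relation `(a' − a) + (b' − b) = 0` with `a', a ∈ A k`, `b' ∈ B k`, `b ∈ B i`, so (X) forces `i = k`
and then (W) forces `a = a'`, i.e. `e = e'`; and `B i ∩ B k = ∅` for `i ≠ k` by (X) with `a = a'`
(`A i ≠ ∅` when `s ≥ 1`; `s = 0` is trivial).  Hence `|E| · |S| · s ≤ 2N`.  Generalises the
disprover's `common_pattern_bound` (`A i ⊇ t i + E`) and `translate_bound_tight`. -/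
def stub_commonDifferencePacking : Prop :=
  ∀ (N n s : ℕ) (A B : Fin n → Finset ℤ), IsIntConfig N n s A B →
    ∀ (S : Finset (Fin n)) (E : Finset ℤ), E ⊆ Finset.Ico (0 : ℤ) N →
    (∀ i ∈ S, ∀ e ∈ E, ∀ e' ∈ E, ∃ a ∈ A i, ∃ a' ∈ A i, e - e' = a - a') →
    E.card * (S.card * s) ≤ 2 * N

/-- STUB 3 (fat-contact rigidity in the dense regime — an inverse theorem; OPEN, size L).
In a dense (`ε N < n s`), non-porous (`8·escapes < n² s²`) configuration in which at least `n² s²/8`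
cross pairs are fat contacts at level `U ≥ δ s − 1`, for `s ≥ s₀(ε, δ, K)` there are a subfamily `S`
and a set `E ⊂ [0, N)` with `E − E ⊆ A i − A i` for every `i ∈ S` and `|S| · |E| ≥ K · n`.
Why plausible: a fat contact shift `d ∈ Z_{ij}` gives `F = A i ∩ (A j + d) = (A j + d) ∩ X`
(isolation), `|F| > δ s − 1`, and `F − F ⊆ (A i − A i) ∩ (A j − A j)`; a constant fraction of all
ORDERED cross pairs being fat forces near-maximal cross energies `E(A i, A j) ≳ δ s³` on a dense graph
of class pairs, hence (Balog–Szemerédi–Gowers + Freiman; Mathlib: `Finset.addEnergy`, Plünnecke–Ruzsa,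
`Finset.ruzsa_covering_add`, small-doubling results — no BSG/Freiman in the needed form) large
progression-like pieces whose local lattices must agree on a positive fraction of classes; the
conclusion asks only `|S||E| ≫ n` (all classes sharing `E = [0, √s)` qualifies; translates give
`E = [0, s)`).  The density and non-porosity hypotheses are LOAD-BEARING: sparse "generalised translate"
families `A i = iD + Q i`, `B i = iD + M·[0,s)` with incoherent Bohr-type shapes `Q i` are
fat-PAIR-dominated with `|S||E| = O(n/δ)` only (they are porous, escape fraction ≈ 1), so no A-side-only
or density-free version should be attempted.  Why it might fail: a dense non-porous family might realise
fat contacts through unboundedly many mutually incommensurable local lattices (Bohr sets of independent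
frequencies), for which `sup |S||E| ≍ n/δ`; the bet is that (W) (`(A i − A i) ∩ (B i − B i) = {0}`)
together with contact-domination (`B i − B j ⊇` most of `A i − A j`) excludes this at density `ε`. -/
def stub_fatContactRigidity : Prop :=
  ∀ ε : ℝ, 0 < ε → ∀ δ : ℝ, 0 < δ → ∀ K : ℝ, ∃ s₀ : ℕ, ∀ (N n s U : ℕ) (A B : Fin n → Finset ℤ),
    IsIntConfig N n s A B → s₀ ≤ s → ε * (N : ℝ) < (n : ℝ) * (s : ℝ) → δ * (s : ℝ) ≤ (U : ℝ) + 1 →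
    8 * escapes A B < n ^ 2 * s ^ 2 → n ^ 2 * s ^ 2 ≤ 8 * fatContacts U A B →
    ∃ (S : Finset (Fin n)) (E : Finset ℤ), E ⊆ Finset.Ico (0 : ℤ) N ∧
      (∀ i ∈ S, ∀ e ∈ E, ∀ e' ∈ E, ∃ a ∈ A i, ∃ a' ∈ A i, e - e' = a - a') ∧
      K * (n : ℝ) ≤ (S.card : ℝ) * (E.card : ℝ)

/-- STUB 4 (porous increment — the HARDEST stub; OPEN, size XL; this is where the card's branch (P)
output must be consumed).  A dense (`ε N < n s`) POROUS configuration (at least `n² s²/8` cross pairs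
are escapes: for an average class `j`, `≥ |Y|/8` translates `B j + d`, `d ∈ (−N, N)`, lie in the
complement of `Y`; the shadows `Y − B j` are far from full and each such `B j` carries a Fourier
coefficient of relative size `≳ ε` at its own frequency) admits, once `s ≥ s₀(ε)`, a configuration
with the SAME class size `s` at a strictly smaller scale `N' < N` and strictly larger density
(`n/N < n'/N'`).  Long sub-progressions of `[0, N)` (A-parts in one, B-parts in a parallel one)
re-coordinatise to integer scales WITHOUT loss, so a relative density increment of the whole family on
such a progression discharges it; no rate is required.  Why it might fail: the per-class biases sit at
different frequencies and no increment of a FAMILY functional that keeps whole classes is known (route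
docstrings of stmt-14310/14311); near-extremal porous families (translates: density `1/s`, escape
fraction `1 − 1/s`) admit NO strict increment at smaller scales, so the density hypothesis is
load-bearing and the statement is as strong as the crux on porous configurations. -/
def stub_porousIncrement : Prop :=
  ∀ ε : ℝ, 0 < ε → ∃ s₀ : ℕ, ∀ (N n s : ℕ) (A B : Fin n → Finset ℤ),
    IsIntConfig N n s A B → s₀ ≤ s → ε * (N : ℝ) < (n : ℝ) * (s : ℝ) →
    n ^ 2 * s ^ 2 ≤ 8 * escapes A B →
    ∃ (N' n' : ℕ) (A' B' : Fin n' → Finset ℤ), N' < N ∧ IsIntConfig N' n' s A' B' ∧ n * N' < n' * N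

end Spec

/-! ## Registered stubs (statement text = the corresponding `Spec.stub_…`, verbatim; `PrimeDensityDecay_proof`
below makes the kernel enforce the agreement) -/

/-- Registered stub 1 — see `Spec.stub_thinContactWall` for the informal statement and proof sketch. -/
theorem stub_thinContactWall :
    ∀ ε : ℝ, 0 < ε → ∃ s₀ : ℕ, ∀ (N n s U : ℕ) (A B : Fin n → Finset ℤ),
      IsIntConfig N n s A B → s₀ ≤ s → ε * (N : ℝ) < (n : ℝ) * (s : ℝ) → (U : ℝ) ≤ ε * s / 8 →
      8 * escapes A B < n ^ 2 * s ^ 2 →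
      n ^ 2 * s ^ 2 ≤ 8 * fatContacts U A B := by
  sorry

/-- Registered stub 2 — see `Spec.stub_commonDifferencePacking` for the informal statement and proof sketch. -/
theorem stub_commonDifferencePacking :
    ∀ (N n s : ℕ) (A B : Fin n → Finset ℤ), IsIntConfig N n s A B →
      ∀ (S : Finset (Fin n)) (E : Finset ℤ), E ⊆ Finset.Ico (0 : ℤ) N →
      (∀ i ∈ S, ∀ e ∈ E, ∀ e' ∈ E, ∃ a ∈ A i, ∃ a' ∈ A i, e - e' = a - a') →
      E.card * (S.card * s) ≤ 2 * N := by
  sorry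

/-- Registered stub 3 — see `Spec.stub_fatContactRigidity` for the informal statement and proof sketch. -/
theorem stub_fatContactRigidity :
    ∀ ε : ℝ, 0 < ε → ∀ δ : ℝ, 0 < δ → ∀ K : ℝ, ∃ s₀ : ℕ, ∀ (N n s U : ℕ) (A B : Fin n → Finset ℤ),
      IsIntConfig N n s A B → s₀ ≤ s → ε * (N : ℝ) < (n : ℝ) * (s : ℝ) → δ * (s : ℝ) ≤ (U : ℝ) + 1 →
      8 * escapes A B < n ^ 2 * s ^ 2 → n ^ 2 * s ^ 2 ≤ 8 * fatContacts U A B →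
      ∃ (S : Finset (Fin n)) (E : Finset ℤ), E ⊆ Finset.Ico (0 : ℤ) N ∧
        (∀ i ∈ S, ∀ e ∈ E, ∀ e' ∈ E, ∃ a ∈ A i, ∃ a' ∈ A i, e - e' = a - a') ∧
        K * (n : ℝ) ≤ (S.card : ℝ) * (E.card : ℝ) := by
  sorry

/-- Registered stub 4 — see `Spec.stub_porousIncrement` for the informal statement and proof sketch. -/
theorem stub_porousIncrement :
    ∀ ε : ℝ, 0 < ε → ∃ s₀ : ℕ, ∀ (N n s : ℕ) (A B : Fin n → Finset ℤ),
      IsIntConfig N n s A B → s₀ ≤ s → ε * (N : ℝ) < (n : ℝ) * (s : ℝ) →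
      n ^ 2 * s ^ 2 ≤ 8 * escapes A B →
      ∃ (N' n' : ℕ) (A' B' : Fin n' → Finset ℤ), N' < N ∧ IsIntConfig N' n' s A' B' ∧ n * N' < n' * N := by
  sorry

/-! ## Composition (kernel-checked, no sorry) -/

/-- The four stubs prove the crux BY NAME.  Read the `ZMod p` configuration in `[0, p) ⊂ ℤ`
(casting `ℤ → ZMod p` can only delete solutions of `(a − a') + (b − b') = 0`, so (W),(X) persist and
the density `n s / p` is unchanged), take a minimal bad scale `N₀` (a scale carrying an integer
configuration of class size `s` and density `> ε`), and split: porous ⇒ stub 4 gives a bad scale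
`< N₀`; not porous ⇒ stub 1 (with `U = ⌊ε s / 8⌋`) gives fat contacts, stub 3 gives `(S, E)` with
`(2/ε)·n ≤ |S||E|`, stub 2 gives `|E||S|·s ≤ 2N₀`, against `ε N₀ < n s`. -/
theorem PrimeDensityDecay_of :
    Spec.stub_thinContactWall → Spec.stub_commonDifferencePacking → Spec.stub_fatContactRigidity →
      Spec.stub_porousIncrement → PrimeDensityDecay := by
  intro h1 h2 h3 h4 ε hε
  obtain ⟨s₁, H1⟩ := h1 ε hε
  obtain ⟨s₃, H3⟩ := h3 ε hε (ε / 8) (by positivity) (2 / ε)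
  obtain ⟨s₄, H4⟩ := h4 ε hε
  refine ⟨s₁ + s₃ + s₄ + 1, ?_⟩
  intro p hp n s A B hs hcard hW hX
  by_contra hcon
  have hcon : ε * (p : ℝ) < (n : ℝ) * (s : ℝ) := lt_of_not_ge hcon
  have hs₁ : s₁ ≤ s := by omega
  have hs₃ : s₃ ≤ s := by omega
  have hs₄ : s₄ ≤ s := by omega
  have hs1 : 1 ≤ s := by omega
  haveI : Fact p.Prime := ⟨hp⟩
  -- Step 1: read the configuration in [0, p) ⊂ ℤ.
  let ι : ZMod p → ℤ := fun x => ((ZMod.val x : ℕ) : ℤ)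
  have hι : Function.Injective ι := by
    intro x y hxy
    have hxy0 : ((ZMod.val x : ℕ) : ℤ) = ((ZMod.val y : ℕ) : ℤ) := hxy
    have hxy' : ZMod.val x = ZMod.val y := by exact_mod_cast hxy0
    exact ZMod.val_injective p hxy'
  have hιcast : ∀ x : ZMod p, ((ι x : ℤ) : ZMod p) = x := by
    intro x
    simp [ι]
  have hrange : ∀ x : ZMod p, ι x ∈ Finset.Ico (0 : ℤ) (p : ℕ) := by
    intro x
    simp only [Finset.mem_Ico, ι]
    refine ⟨by positivity, ?_⟩
    exact_mod_cast ZMod.val_lt x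
  let A' : Fin n → Finset ℤ := fun i => (A i).image ι
  let B' : Fin n → Finset ℤ := fun i => (B i).image ι
  have hcfg : IsIntConfig p n s A' B' := by
    refine ⟨?_, ?_, ?_, ?_, ?_⟩
    · intro i y hy
      obtain ⟨x, -, rfl⟩ := Finset.mem_image.1 hy
      exact hrange x
    · intro i y hy
      obtain ⟨x, -, rfl⟩ := Finset.mem_image.1 hy
      exact hrange x
    · intro i
      refine ⟨?_, ?_⟩
      · simp only [A', Finset.card_image_of_injective _ hι]
        exact (hcard i).1
      · simp only [B', Finset.card_image_of_injective _ hι]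
        exact (hcard i).2
    · intro i a ha a' ha' b hb b' hb' hsum
      obtain ⟨x, hx, rfl⟩ := Finset.mem_image.1 ha
      obtain ⟨x', hx', rfl⟩ := Finset.mem_image.1 ha'
      obtain ⟨y, hy, rfl⟩ := Finset.mem_image.1 hb
      obtain ⟨y', hy', rfl⟩ := Finset.mem_image.1 hb'
      have hz : (x - x') + (y - y') = (0 : ZMod p) := by
        have h := congrArg (fun z : ℤ => (z : ZMod p)) hsum
        simp only [Int.cast_add, Int.cast_sub, Int.cast_zero, hιcast] at h
        exact h
      obtain ⟨e1, e2⟩ := hW i x hx x' hx' y hy y' hy' hz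
      exact ⟨by rw [e1], by rw [e2]⟩
    · intro i j k a ha a' ha' b hb b' hb' hsum
      obtain ⟨x, hx, rfl⟩ := Finset.mem_image.1 ha
      obtain ⟨x', hx', rfl⟩ := Finset.mem_image.1 ha'
      obtain ⟨y, hy, rfl⟩ := Finset.mem_image.1 hb
      obtain ⟨y', hy', rfl⟩ := Finset.mem_image.1 hb'
      have hz : (x - x') + (y - y') = (0 : ZMod p) := by
        have h := congrArg (fun z : ℤ => (z : ZMod p)) hsum
        simp only [Int.cast_add, Int.cast_sub, Int.cast_zero, hιcast] at h
        exact h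
      exact hX i j k x hx x' hx' y hy y' hy' hz
  -- Step 2: minimal bad scale.
  have hbad : ∃ N : ℕ, ∃ (m : ℕ) (A₁ B₁ : Fin m → Finset ℤ),
      IsIntConfig N m s A₁ B₁ ∧ ε * (N : ℝ) < (m : ℝ) * (s : ℝ) :=
    ⟨p, n, A', B', hcfg, hcon⟩
  have hspec := Nat.find_spec hbad
  have hmin : ∀ N' : ℕ, N' < Nat.find hbad → ¬ ∃ (m : ℕ) (A₁ B₁ : Fin m → Finset ℤ),
      IsIntConfig N' m s A₁ B₁ ∧ ε * (N' : ℝ) < (m : ℝ) * (s : ℝ) :=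
    fun N' h => Nat.find_min hbad h
  set N₀ : ℕ := Nat.find hbad with hN₀
  obtain ⟨m, A₀, B₀, hcfg₀, hdens₀⟩ := hspec
  have hs0 : (0 : ℝ) ≤ s := by positivity
  by_cases hporous : m ^ 2 * s ^ 2 ≤ 8 * escapes A₀ B₀
  · -- Step 3: porous ⇒ a smaller bad scale, contradicting minimality.
    obtain ⟨N', m', A₂, B₂, hlt, hcfg₂, hinc⟩ := H4 N₀ m s A₀ B₀ hcfg₀ hs₄ hdens₀ hporous
    apply hmin N' hlt
    refine ⟨m', A₂, B₂, hcfg₂, ?_⟩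
    have hincR : (m : ℝ) * (N' : ℝ) < (m' : ℝ) * (N₀ : ℝ) := by exact_mod_cast hinc
    rcases Nat.eq_zero_or_pos N' with hN' | hN'
    · subst hN'
      have hm' : 0 < m' := by
        rcases Nat.eq_zero_or_pos m' with h0 | h0
        · subst h0; simp at hinc
        · exact h0
      have hm'R : (0 : ℝ) < m' := by exact_mod_cast hm'
      have hsR : (0 : ℝ) < s := by exact_mod_cast hs1
      simp only [Nat.cast_zero, mul_zero]
      positivity
    · have hN'R : (0 : ℝ) < N' := by exact_mod_cast hN'
      have hN₀R : (0 : ℝ) ≤ N₀ := by positivity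
      have h3 : ε * (N' : ℝ) * (N₀ : ℝ) < (m' : ℝ) * (s : ℝ) * (N₀ : ℝ) :=
        calc ε * (N' : ℝ) * (N₀ : ℝ) = ε * (N₀ : ℝ) * (N' : ℝ) := by ring
          _ < (m : ℝ) * (s : ℝ) * (N' : ℝ) := mul_lt_mul_of_pos_right hdens₀ hN'R
          _ = (m : ℝ) * (N' : ℝ) * (s : ℝ) := by ring
          _ ≤ (m' : ℝ) * (N₀ : ℝ) * (s : ℝ) := mul_le_mul_of_nonneg_right hincR.le hs0
          _ = (m' : ℝ) * (s : ℝ) * (N₀ : ℝ) := by ring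
      exact lt_of_mul_lt_mul_right h3 hN₀R
  · -- Step 4: not porous ⇒ fat contacts (stub 1) ⇒ rigidity (stub 3) + packing (stub 2).
    have hnp : 8 * escapes A₀ B₀ < m ^ 2 * s ^ 2 := lt_of_not_ge hporous
    set U : ℕ := ⌊ε * s / 8⌋₊ with hU
    have hUle : (U : ℝ) ≤ ε * s / 8 := Nat.floor_le (by positivity)
    have hUlow : ε / 8 * (s : ℝ) ≤ (U : ℝ) + 1 := by
      have h := Nat.lt_floor_add_one (ε * s / 8)
      have e : ε / 8 * (s : ℝ) = ε * s / 8 := by ring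
      rw [e]
      exact h.le
    have hfat := H1 N₀ m s U A₀ B₀ hcfg₀ hs₁ hdens₀ hUle hnp
    obtain ⟨S, E, hE, hEE, hK⟩ := H3 N₀ m s U A₀ B₀ hcfg₀ hs₃ hdens₀ hUlow hnp hfat
    have hpack := h2 N₀ m s A₀ B₀ hcfg₀ S E hE hEE
    have hpackR : (E.card : ℝ) * ((S.card : ℝ) * (s : ℝ)) ≤ 2 * (N₀ : ℝ) := by
      exact_mod_cast hpack
    have h2m : 2 * (m : ℝ) ≤ (S.card : ℝ) * (E.card : ℝ) * ε := by
      have h := mul_le_mul_of_nonneg_right hK hε.le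
      have e : 2 / ε * (m : ℝ) * ε = 2 * (m : ℝ) := by
        field_simp
      linarith [h, e]
    have key : 2 * ((m : ℝ) * (s : ℝ)) ≤ 2 * (ε * (N₀ : ℝ)) :=
      calc 2 * ((m : ℝ) * (s : ℝ)) = (2 * (m : ℝ)) * (s : ℝ) := by ring
        _ ≤ ((S.card : ℝ) * (E.card : ℝ) * ε) * (s : ℝ) := mul_le_mul_of_nonneg_right h2m hs0
        _ = ε * ((E.card : ℝ) * ((S.card : ℝ) * (s : ℝ))) := by ring
        _ ≤ ε * (2 * (N₀ : ℝ)) := mul_le_mul_of_nonneg_left hpackR hε.le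
        _ = 2 * (ε * (N₀ : ℝ)) := by ring
    linarith [key, hdens₀]

/-- The skeleton IS the crux proof once the four stubs are discharged (kernel-checked application; today it
depends on `sorryAx` through the stubs only). -/
theorem PrimeDensityDecay_proof : PrimeDensityDecay :=
  PrimeDensityDecay_of stub_thinContactWall stub_commonDifferencePacking stub_fatContactRigidity
    stub_porousIncrement

end Summit.MatrixMultiplication.MatrixMultiplication.Cruxes.PrimeDensityDecay.PairShadowIdentity
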